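import Summits.CriticalPhenomena.PercolationContinuityZ3.Theorems.PercNearOneGluingNoHeavyLowerTailSahiE3BlockTransfer
import Mathlib.Tactic.Linarith
import Mathlib.Tactic.Ring
import Mathlib.Tactic.Positivity
import HarnessLib

/-!
# `NoHeavyLowerTail` (crux stmt-CriticalPhenomena-4575), Sahi programme P4 (monotone coupling / transport):
# Sahi's `E₃ ≥ 0` on the weighted cube whenever the PRODUCT of two of the three functions is a cylinder indicator
# (for events: whenever the INTERSECTION of two of the three up-sets is a PRINCIPAL up-set)

Support file (cell `prim-l12`, seat P4 "Holley / monotone coupling / transport", generation 3;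
`--supports stmt-CriticalPhenomena-4575`).  No named facts, no sorries, no new definitions.

## Context

Sahi's third functional (Richards' conjugate cumulant) `E₃(u,f,g) = 2E[ufg] + Eu·Ef·Eg − Eu·E[fg] − Ef·E[ug] − Eg·E[uf]`
is conjectured nonnegative for monotone nonnegative `u, f, g` under every product (indeed every FKG) measure
[Sahi 2008, Conj. 5; Kahn 2022, Conj. 5; Gladkov arXiv:2408.08457 Rem. 8.8: "still a conjecture"] — OPEN even on `{0,1}^k`.
The proved classes in print are: one function a CYLINDER indicator / cumulation (Sahi 2008 Thm 2, Blinovsky 2014; tree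
`latticeE3_nonneg_of_principal`, and on the weighted cube `sahiE3_cylinder_nonneg` of the sibling file `…SahiE3Cylinder`), more
generally one slot leaving the other two conditionally positively correlated (`prodBernoulli_sahiE3_nonneg_of_condHarris`),
nested pairs / containment (`…SahiE3UnionContainment`), Lieb–Sahi's planar and rectangle cases, chains.

## What is proved here (new class; [this work])

**`sahiE3_nonneg_of_mul_eq_cylinder`.**  On the weighted cube on `a ∪ D` (`a ∩ D = ∅`, arbitrary coordinate probabilities
`p ∈ [0,1]^ι`): if `u, f, g` are monotone along `⊆` and nonnegative and `f·g = 1[a ⊆ ·]` on the configurations of `a ∪ D`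
(for indicators: `f = 1_A`, `g = 1_B` with `A ∩ B = {S | a ⊆ S}` the principal up-set / cylinder generated by `a`), then
`E₃(u, f, g) ≥ 0` — for EVERY monotone `u ≥ 0`.  Neither `f` nor `g` need be a cylinder (e.g. on five coordinates
`A = {1 ∈ S ∧ (2 ∈ S ∨ 3 ∈ S ∨ 5 ∈ S)}`, `B = {2 ∈ S ∧ (1 ∈ S ∨ 4 ∈ S)}`, `A ∩ B = {1,2 ∈ S}`), and conditioning on `A`, on
`B` or on `u` may make the other two NEGATIVELY correlated, so the class is not contained in the conditional-Harris class.
By the symmetry of `E₃` the hypothesis may concern any two of the three slots.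

## Proof (the transport reading: a FIBRE-LOCAL monotone coupling; half a page)

Write `C = a ∪ D`, `π = ∏_{i∈a} p_i = E[fg]`, `A = Ef`, `B = Eg` (so `AB ≤ π`, Harris), and for a configuration `Z ⊆ D` of the
free coordinates let `F_A(Z) = E_a[T ↦ f(Z ∪ T)]`, `F_B(Z) = E_a[T ↦ g(Z ∪ T)]` be the block averages over the fibre
`{Z ∪ T : T ⊆ a}` (monotone in `Z`; `A = E_D F_A`, `B = E_D F_B` by Fubini), with top values `A* = F_A(D)`, `B* = F_B(D)`.
1. FIRST-SLOT LINEARITY: `E₃(u,f,g) = E_C[u · dens]` with `dens = 2fg + (AB − π) − A·g − B·f`; off the cylinder `fg = 0` and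
   `dens ≤ AB − π ≤ 0`.  Hence replacing `u` by the larger cylinder function `ũ(S) = u(a ∪ S)` (equal to `u` on the cylinder)
   can only DECREASE `E₃`:  `E₃(u,f,g) ≥ E_C[ũ · dens]`  (the saturation step of `…SahiE3Saturation`, here for functions).
2. FUBINI over the fibres: `E_C[ũ · dens] = E_D[Z ↦ u(a ∪ Z) · Γ(Z)]` with the fibre surplus
   `Γ(Z) = E_a[T ↦ dens(Z ∪ T)] = π + AB − A·F_B(Z) − B·F_A(Z)`  (`E_a[T ↦ (fg)(Z ∪ T)] = π`: only `T = a` completes the cylinder).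
3. THE FIBRE SURPLUS IS NONNEGATIVE: `F_A ≤ A*`, `F_B ≤ B*`, so
   `Γ(Z) ≥ π + AB − A·B* − B·A* = (π − A*·B*) + (A* − A)(B* − B) ≥ 0`,
   because `A ≤ A*`, `B ≤ B*` (averages below the top fibre) and `A*·B* ≤ E_a[f(D ∪ ·)·g(D ∪ ·)] = π` — HARRIS ON THE BLOCK `a`
   for the top fibre, whose two sections meet only in the full configuration.  With `u ≥ 0` this gives `E₃ ≥ 0`.
Transport reading (cf. `…C3Transport`, `HasC3Flow`): for the pair `(f,g) = (1_A,1_B)` with `A ∩ B` a cylinder the `C₃`-flow can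
be taken FIBRE-LOCAL — every configuration `Z ∪ T` outside the cylinder sends all its supply straight up to the top `Z ∪ a` of
its own fibre — and `Γ(Z) ≥ 0` is exactly the statement that the capacity `κ·μ(Z ∪ a)` of the top point absorbs the supply of
its fibre; in particular the seat's conjecture R7 (`C3MinimalCovFlowConjectureCube`: covariance mass inserted at minimal
elements) holds on this class, the minimal element of `(A ∩ B) ∩ ↑y` being unique (`y ∪ a`).

Contents: `ED_ite_subset_union` (the block integral of the cylinder indicator over a fibre), `ED_const`,
`union_union_eq_of_subset`, the theorem, and its event form `sahiE3_ind_nonneg_of_inter_eq_cylinder` (up-closed predicates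
`U, A, B` with `A ∧ B ↔ (a ⊆ ·)`).  Uses `ED_union` (Fubini), `ED_cylinder_mul`, `ED_mul_ED_le_ED_mul` (Harris on
the weighted cube, from Gladkov–Zimin) of the sibling files `…SahiE3Cylinder`, `…SahiE3BlockTransfer`.
-/

noncomputable section

namespace Summit.CriticalPhenomena.PercolationContinuityZ3.Theorems

namespace SahiE3PrincipalMeet

open Finset Literature.Probability.Percolation Literature.Probability.Percolation.DecisionTree

variable {ι : Type*} [DecidableEq ι]

/-- The expectation of a constant on the weighted cube is the constant (total mass one). [folklore] -/
theorem ED_const (D : Finset ι) (p : ι → ℝ) (c : ℝ) : ED D p (fun _ => c) = c := by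
  have h := ED_mul_left D p c (fun _ => (1 : ℝ))
  simp only [mul_one] at h
  rw [h, ED_one, mul_one]

/-- **The block integral of the cylinder indicator over a fibre.**  For `Z` disjoint from the block `a`,
`E_a[T ↦ 1[a ⊆ Z ∪ T]] = ∏_{i ∈ a} p_i`: among the sub-configurations `T ⊆ a` only `T = a` completes the cylinder. [folklore] -/
theorem ED_ite_subset_union (a Z : Finset ι) (hZa : Disjoint Z a) (p : ι → ℝ) :
    ED a p (fun T => if a ⊆ Z ∪ T then (1 : ℝ) else 0) = ∏ i ∈ a, p i := by
  unfold ED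
  rw [Finset.sum_eq_single_of_mem a (Finset.mem_powerset.2 (Finset.Subset.refl a))]
  · beta_reduce
    rw [if_pos Finset.subset_union_right, mul_one]
    unfold wtW
    exact Finset.prod_congr rfl fun i hi => by rw [if_pos hi]
  · intro T hT hTa
    have hTsub : T ⊆ a := Finset.mem_powerset.1 hT
    have hnot : ¬ a ⊆ Z ∪ T := by
      intro h
      apply hTa
      refine Finset.Subset.antisymm hTsub fun i hi => ?_
      rcases Finset.mem_union.1 (h hi) with hiZ | hiT
      · exact absurd hi (Finset.disjoint_left.1 hZa hiZ)
      · exact hiT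
    beta_reduce
    rw [if_neg hnot, mul_zero]

omit [DecidableEq ι] in
/-- `a ∪ (Z ∪ T) = a ∪ Z` for `T ⊆ a`. [folklore] -/
theorem union_union_eq_of_subset {a Z T : Finset ι} [DecidableEq ι] (hT : T ⊆ a) : a ∪ (Z ∪ T) = a ∪ Z := by
  ext i
  simp only [Finset.mem_union]
  constructor
  · rintro (h | h | h)
    · exact Or.inl h
    · exact Or.inr h
    · exact Or.inl (hT h)
  · rintro (h | h)
    · exact Or.inl h
    · exact Or.inr (Or.inl h)

/-- **Sahi's `E₃ ≥ 0` when the product of two of the functions is a cylinder indicator** (for events: when the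
intersection of two of the three up-sets is a principal up-set).  On the weighted cube on `a ∪ D` (`a ∩ D = ∅`,
coordinate probabilities `p ∈ [0,1]`), for `u, f, g` monotone along `⊆` and nonnegative with `f S · g S = 1[a ⊆ S]` for all
`S ⊆ a ∪ D`:
`2E[ufg] + Eu·Ef·Eg − Eu·E[fg] − Ef·E[ug] − Eg·E[uf] ≥ 0`.
Proof: fibre-local transport — saturate `u` to the cylinder function `S ↦ u(a ∪ S)` (first-slot linearity, the density is
`≤ 0` off the cylinder), integrate each fibre `{Z ∪ T : T ⊆ a}` over the block, and bound the fibre surplus by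
`(π − A*B*) + (A* − Ef)(B* − Eg) ≥ 0` (Harris on the block for the top fibre; block averages are below their top values).
[original; a new case of Sahi 2008 Conj. 5 / Kahn 2022 Conj. 5 / Richards' inequality, not covered by the cylinder,
conditional-Harris, nested or Lieb–Sahi classes] -/
theorem sahiE3_nonneg_of_mul_eq_cylinder (a D : Finset ι) (had : Disjoint a D) {p : ι → ℝ}
    (hp0 : ∀ i, 0 ≤ p i) (hp1 : ∀ i, p i ≤ 1) {u f g : Finset ι → ℝ}
    (hu : ∀ ⦃S T : Finset ι⦄, S ⊆ T → u S ≤ u T) (hu0 : ∀ S, 0 ≤ u S)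
    (hf : ∀ ⦃S T : Finset ι⦄, S ⊆ T → f S ≤ f T) (hf0 : ∀ S, 0 ≤ f S)
    (hg : ∀ ⦃S T : Finset ι⦄, S ⊆ T → g S ≤ g T) (hg0 : ∀ S, 0 ≤ g S)
    (hfg : ∀ S, S ⊆ a ∪ D → f S * g S = if a ⊆ S then 1 else 0) :
    0 ≤ 2 * ED (a ∪ D) p (fun S => u S * f S * g S)
          + ED (a ∪ D) p u * ED (a ∪ D) p f * ED (a ∪ D) p g
          - ED (a ∪ D) p u * ED (a ∪ D) p (fun S => f S * g S)
          - ED (a ∪ D) p f * ED (a ∪ D) p (fun S => u S * g S)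
          - ED (a ∪ D) p g * ED (a ∪ D) p (fun S => u S * f S) := by
  have hDa : Disjoint D a := had.symm
  -- Fubini over the fibres `{Z ∪ T : T ⊆ a}`, `Z ⊆ D`
  have fub : ∀ φ : Finset ι → ℝ, ED (a ∪ D) p φ = ED D p (fun Z => ED a p (fun T => φ (Z ∪ T))) := fun φ => by
    rw [Finset.union_comm]; exact ED_union D a hDa p φ
  -- abbreviations
  set π : ℝ := ∏ i ∈ a, p i with hπ
  set A : ℝ := ED (a ∪ D) p f with hA
  set B : ℝ := ED (a ∪ D) p g with hB
  set FA : Finset ι → ℝ := fun Z => ED a p (fun T => f (Z ∪ T)) with hFA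
  set FB : Finset ι → ℝ := fun Z => ED a p (fun T => g (Z ∪ T)) with hFB
  set As : ℝ := FA D with hAs
  set Bs : ℝ := FB D with hBs
  -- (0) the product integrates to `π`
  have hfgπ : ED (a ∪ D) p (fun S => f S * g S) = π := by
    rw [ED_congr_sub (a ∪ D) p (φ := fun S => f S * g S) (ψ := fun S => if a ⊆ S then (1 : ℝ) else 0) hfg]
    have h := ED_cylinder_mul a D had p (fun _ => (1 : ℝ))
    rw [ED_one, mul_one] at h
    exact h
  -- (1) signs and Harris on the whole cube
  have hA0 : 0 ≤ A := ED_nonneg (a ∪ D) hp0 hp1 fun S _ => hf0 S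
  have hB0 : 0 ≤ B := ED_nonneg (a ∪ D) hp0 hp1 fun S _ => hg0 S
  have hABπ : A * B ≤ π := by
    have h := ED_mul_ED_le_ED_mul (a ∪ D) hp0 hp1 hf hg
    rw [hfgπ] at h
    exact h
  -- (2) block averages: monotone in the fibre, below the top fibre; averages below the top values
  have hFA_le : ∀ Z, Z ⊆ D → FA Z ≤ As := fun Z hZ =>
    ED_mono a hp0 hp1 fun T _ => hf (Finset.union_subset_union hZ (Finset.Subset.refl T))
  have hFB_le : ∀ Z, Z ⊆ D → FB Z ≤ Bs := fun Z hZ =>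
    ED_mono a hp0 hp1 fun T _ => hg (Finset.union_subset_union hZ (Finset.Subset.refl T))
  have hA_le : A ≤ As := by
    have h1 : A = ED D p FA := fub f
    rw [h1, ← ED_const D p As]
    exact ED_mono D hp0 hp1 fun Z hZ => hFA_le Z hZ
  have hB_le : B ≤ Bs := by
    have h1 : B = ED D p FB := fub g
    rw [h1, ← ED_const D p Bs]
    exact ED_mono D hp0 hp1 fun Z hZ => hFB_le Z hZ
  -- (3) Harris on the block for the top fibre, whose sections meet only at the full configuration
  have hfg_fibre : ∀ Z, Z ⊆ D → ED a p (fun T => f (Z ∪ T) * g (Z ∪ T)) = π := by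
    intro Z hZ
    have hZa : Disjoint Z a := Finset.disjoint_of_subset_left hZ hDa
    rw [ED_congr_sub a p (φ := fun T => f (Z ∪ T) * g (Z ∪ T)) (ψ := fun T => if a ⊆ Z ∪ T then (1 : ℝ) else 0)
      (fun T hT => hfg (Z ∪ T) (Finset.union_subset (hZ.trans Finset.subset_union_right)
        (hT.trans Finset.subset_union_left)))]
    exact ED_ite_subset_union a Z hZa p
  have hAsBs : As * Bs ≤ π := by
    have h := ED_mul_ED_le_ED_mul a hp0 hp1
      (f := fun T => f (D ∪ T)) (g := fun T => g (D ∪ T))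
      (fun S T hST => hf (Finset.union_subset_union (Finset.Subset.refl D) hST))
      (fun S T hST => hg (Finset.union_subset_union (Finset.Subset.refl D) hST))
    rw [hfg_fibre D (Finset.Subset.refl D)] at h
    exact h
  -- (4) first-slot linearity: `E₃(u,f,g) = E[u · dens]`
  set dens : Finset ι → ℝ := fun S => 2 * (f S * g S) + (A * B - π) - A * g S - B * f S with hdens
  have hlin : ∀ (X : Finset ι) (v : Finset ι → ℝ),
      ED X p (fun S => v S * dens S) = 2 * ED X p (fun S => v S * f S * g S) + (A * B - π) * ED X p v
        - A * ED X p (fun S => v S * g S) - B * ED X p (fun S => v S * f S) := by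
    intro X v
    unfold ED
    rw [Finset.mul_sum, Finset.mul_sum, Finset.mul_sum, Finset.mul_sum, ← Finset.sum_add_distrib,
      ← Finset.sum_sub_distrib, ← Finset.sum_sub_distrib]
    refine Finset.sum_congr rfl fun S _ => ?_
    simp only [hdens]
    ring
  have hE3 : 2 * ED (a ∪ D) p (fun S => u S * f S * g S)
          + ED (a ∪ D) p u * ED (a ∪ D) p f * ED (a ∪ D) p g
          - ED (a ∪ D) p u * ED (a ∪ D) p (fun S => f S * g S)
          - ED (a ∪ D) p f * ED (a ∪ D) p (fun S => u S * g S)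
          - ED (a ∪ D) p g * ED (a ∪ D) p (fun S => u S * f S)
        = ED (a ∪ D) p (fun S => u S * dens S) := by
    rw [hlin (a ∪ D) u, hfgπ]
    ring
  rw [hE3]
  -- (5) saturation: replacing `u` by the cylinder function `S ↦ u (a ∪ S)` decreases `E[u · dens]`
  have hdens_nonpos : ∀ S, S ⊆ a ∪ D → ¬ a ⊆ S → dens S ≤ 0 := by
    intro S hS haS
    have h0 : f S * g S = 0 := by rw [hfg S hS, if_neg haS]
    have h1 : 0 ≤ A * g S := mul_nonneg hA0 (hg0 S)
    have h2 : 0 ≤ B * f S := mul_nonneg hB0 (hf0 S)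
    simp only [hdens]
    rw [h0]
    linarith
  have hsat : ED (a ∪ D) p (fun S => u (a ∪ S) * dens S) ≤ ED (a ∪ D) p (fun S => u S * dens S) := by
    refine ED_mono (a ∪ D) hp0 hp1 fun S hS => ?_
    by_cases haS : a ⊆ S
    · rw [Finset.union_eq_right.2 haS]
    · exact mul_le_mul_of_nonpos_right (hu Finset.subset_union_right) (hdens_nonpos S hS haS)
  refine le_trans ?_ hsat
  -- (6) Fubini and the fibre surplus
  rw [fub]
  refine ED_nonneg D hp0 hp1 fun Z hZ => ?_
  show 0 ≤ ED a p (fun T => u (a ∪ (Z ∪ T)) * dens (Z ∪ T))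
  -- on the fibre over `Z` the saturated function is the constant `u (a ∪ Z)`
  have hinner : ED a p (fun T => u (a ∪ (Z ∪ T)) * dens (Z ∪ T)) = u (a ∪ Z) * ED a p (fun T => dens (Z ∪ T)) := by
    rw [ED_congr_sub a p (φ := fun T => u (a ∪ (Z ∪ T)) * dens (Z ∪ T)) (ψ := fun T => u (a ∪ Z) * dens (Z ∪ T))
      (fun T hT => by rw [union_union_eq_of_subset hT]), ED_mul_left]
  rw [hinner]
  refine mul_nonneg (hu0 _) ?_
  -- the fibre surplus `Γ(Z) = π + AB − A·F_B(Z) − B·F_A(Z) ≥ (π − A*B*) + (A* − A)(B* − B) ≥ 0`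
  have hΓ : ED a p (fun T => dens (Z ∪ T)) = π + A * B - A * FB Z - B * FA Z := by
    have h1 : ED a p (fun T => dens (Z ∪ T))
        = 2 * ED a p (fun T => f (Z ∪ T) * g (Z ∪ T)) + (A * B - π) * ED a p (fun _ => (1 : ℝ))
          - A * FB Z - B * FA Z := by
      simp only [hFA, hFB]
      unfold ED
      rw [Finset.mul_sum, Finset.mul_sum, Finset.mul_sum, Finset.mul_sum, ← Finset.sum_add_distrib,
        ← Finset.sum_sub_distrib, ← Finset.sum_sub_distrib]
      refine Finset.sum_congr rfl fun T _ => ?_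
      simp only [hdens]
      ring
    rw [h1, hfg_fibre Z hZ, ED_one]
    ring
  rw [hΓ]
  have h1 : A * FB Z ≤ A * Bs := mul_le_mul_of_nonneg_left (hFB_le Z hZ) hA0
  have h2 : B * FA Z ≤ B * As := mul_le_mul_of_nonneg_left (hFA_le Z hZ) hB0
  nlinarith [mul_nonneg (sub_nonneg.2 hA_le) (sub_nonneg.2 hB_le), hAsBs, h1, h2]

omit [DecidableEq ι] in
/-- Indicators of up-closed predicates are monotone along `⊆`. [folklore] -/
theorem ite_mono_of_upward {X : Finset ι → Prop} [DecidablePred X]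
    (hX : ∀ ⦃S T : Finset ι⦄, S ⊆ T → X S → X T) ⦃S T : Finset ι⦄ (hST : S ⊆ T) :
    (if X S then (1 : ℝ) else 0) ≤ (if X T then (1 : ℝ) else 0) := by
  by_cases hS : X S
  · rw [if_pos hS, if_pos (hX hST hS)]
  · rw [if_neg hS]
    split_ifs
    · exact zero_le_one
    · exact le_rfl

/-- **Event form: Sahi's `E₃(U, A, B) ≥ 0` whenever `A ∩ B` is a principal up-set.**  On the weighted cube on `a ∪ D`
(`a ∩ D = ∅`, `p ∈ [0,1]`), for up-closed predicates `U, A, B` on configurations with `A S ∧ B S ↔ a ⊆ S` for every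
`S ⊆ a ∪ D` (the intersection of `A` and `B` is the cylinder generated by `a`; `U` arbitrary):
`2μ(UAB) + μ(U)μ(A)μ(B) − μ(U)μ(AB) − μ(A)μ(UB) − μ(B)μ(UA) ≥ 0`, all masses written as `ED`-expectations of indicators.
[original; corollary of `sahiE3_nonneg_of_mul_eq_cylinder`] -/
theorem sahiE3_ind_nonneg_of_inter_eq_cylinder (a D : Finset ι) (had : Disjoint a D) {p : ι → ℝ}
    (hp0 : ∀ i, 0 ≤ p i) (hp1 : ∀ i, p i ≤ 1) (U A B : Finset ι → Prop) [DecidablePred U] [DecidablePred A]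
    [DecidablePred B] (hU : ∀ ⦃S T : Finset ι⦄, S ⊆ T → U S → U T) (hA : ∀ ⦃S T : Finset ι⦄, S ⊆ T → A S → A T)
    (hB : ∀ ⦃S T : Finset ι⦄, S ⊆ T → B S → B T) (hAB : ∀ S, S ⊆ a ∪ D → (A S ∧ B S ↔ a ⊆ S)) :
    0 ≤ 2 * ED (a ∪ D) p (fun S => (if U S then (1 : ℝ) else 0) * (if A S then (1 : ℝ) else 0) * (if B S then (1 : ℝ) else 0))
          + ED (a ∪ D) p (fun S => if U S then (1 : ℝ) else 0) * ED (a ∪ D) p (fun S => if A S then (1 : ℝ) else 0)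
              * ED (a ∪ D) p (fun S => if B S then (1 : ℝ) else 0)
          - ED (a ∪ D) p (fun S => if U S then (1 : ℝ) else 0)
              * ED (a ∪ D) p (fun S => (if A S then (1 : ℝ) else 0) * (if B S then (1 : ℝ) else 0))
          - ED (a ∪ D) p (fun S => if A S then (1 : ℝ) else 0)
              * ED (a ∪ D) p (fun S => (if U S then (1 : ℝ) else 0) * (if B S then (1 : ℝ) else 0))
          - ED (a ∪ D) p (fun S => if B S then (1 : ℝ) else 0)
              * ED (a ∪ D) p (fun S => (if U S then (1 : ℝ) else 0) * (if A S then (1 : ℝ) else 0)) := by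
  refine sahiE3_nonneg_of_mul_eq_cylinder a D had hp0 hp1 (ite_mono_of_upward hU) (fun S => by positivity)
    (ite_mono_of_upward hA) (fun S => by positivity) (ite_mono_of_upward hB) (fun S => by positivity) ?_
  intro S hS
  by_cases haS : a ⊆ S
  · obtain ⟨h1, h2⟩ := (hAB S hS).2 haS
    rw [if_pos h1, if_pos h2, if_pos haS, mul_one]
  · rw [if_neg haS]
    by_cases h1 : A S
    · have h2 : ¬ B S := fun h2 => haS ((hAB S hS).1 ⟨h1, h2⟩)
      rw [if_neg h2, mul_zero]
    · rw [if_neg h1, zero_mul]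

end SahiE3PrincipalMeet

end Summit.CriticalPhenomena.PercolationContinuityZ3.Theorems

end
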